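import Literature.NumberTheory.GelbartRogawski1991.DoubledSeesawUndoubling
import HarnessLib

/-!
# The doubled see-saw of the `χ`-normalised Weil representations along `blkD` is trivial on BOTH factors, and the UNDOUBLED
# both-slot identity `ω(s_χ^V (X₁ ⊕ X₂)) (Φ₁ ⊠_ι Φ₂) = ω(s_χ^{V₁} X₁) Φ₁ ⊠_ι ω(s_χ^{V₂} X₂) Φ₂` — organ (O44ab) of socket #44∕45R

Track B ∕ hLiu418 = stmt-HodgeConjecture-24832, line `K2_Liu_CurveThetaSigs`, unit U6 ED. 6 socket #44∕45R `sig_K2LiuUndoublingSeparation`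
(«UNDOUBLING + SEPARATION OF VARIABLES»); seat `hodgecm-mathlib-K2Liu-p03` (g3).  Setting of ★ `GelbartRogawski1991/DoubledBlockDiagEmbedding`,
★ `DoubledSeesawParabolic`, ★ `DoubledSeesawUndoubling`: CM field `L`, an orthogonal sum `V = V₁ ⊕ V₂` of diagonal hermitian spaces
(`dV = dA ‖ dB` through `hVA ∕ hVB`), ONE partner `W = diag dW`, enumerations `eV, eA, eB`, the doubled groups `H(X)(𝔸)` with their `χ`-normalised
doubled Weil representations `sD_X` (★ `IsDoubledWeilRep`, unique: ★ `isDoubledWeilRep_unique`), the block embedding `blkD : H(V₁)(𝔸) × H(V₂)(𝔸) →* H(V)(𝔸)`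
and its see-saw character `seesawCharBlkD` (★ `seesawCharBlkD_spec`), and the `χ`-attached compatible splittings `s_χ^X = chiSplitting` of
`G₁(X)(𝔸) = U(X ⊗ W)(𝔸_{L⁺})` obtained by UNDOUBLING.  The tree proves the see-saw character is `1` on `H(V₁)(𝔸) × 1` (★ `seesawCharBlkD_inl_eq_one`) and
the slot-1 undoubled identity (★ `omega_chiSplitting_sumTensor_idxSplit`, `reindex e_Σ e_Σ X = diag(X₁, 1)`).  THIS FILE adds the mirror image and closes
the square:

* §1 `chiDet_mul_modDelta_blkD_inr` — `blkD (1, q)` of a Siegel `q ∈ P_Δ(V₂)(𝔸)` carries the prescribed scalar `χ(det_Δ q)|det_Δ q|^{1/2}` of `q`;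
* §2 `seesawCharBlkD_eq_one_of_isSiegelDelta_inr` — the parabolic comparison at `(1, q)` (the two parabolic clauses of `sD_V`, `sD_{V₂}` at the Θ-test
  vectors, compared through the see-saw scalar `κ` of Weil's `δ`'s, ★ `exists_kappa`); `mpSeesawCharSum_inr_eq_one_of_rigid` (see-saw bookkeeping on the
  second factor) and **`seesawCharBlkD_inr_eq_one`** — `= 1` on `1 × H(V₂)(𝔸)` by the rigidity ★ `IsDoubledWeilRep.monoidHom_eq_one_of_forall_isSiegelDelta`;
* §3 **`seesawCharBlkD_eq_one`** (the see-saw character is TRIVIAL) and **`omega_blkD_sumTensor`**: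
  `ω(sD_V (blkD (h₁, h₂))) (Φ₁ ⊠_σ Φ₂) = ω(sD_{V₁} h₁) Φ₁ ⊠_σ ω(sD_{V₂} h₂) Φ₂` — the doubled Weil representation of `V₁ ⊕ V₂` RESTRICTS to the outer tensor
  product of those of `V₁` and `V₂` ([Kudla1994, §2, Thm. 3.1: splittings are additive in `V`]; [HarrisKudlaSweet1996, §1 (1.8)–(1.9)]; [Kudla1984, §1]);
* §4 **`omega_chiSplitting_sumTensor_idxSplit₂`** — undoubled: for `X ∈ G₁(V)(𝔸)` with `reindex e_Σ e_Σ X = diag(X₁, X₂)`,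
  `ω(s_χ^V X) (Φ₁ ⊠_ι Φ₂) = ω(s_χ^{V₁} X₁) Φ₁ ⊠_ι ω(s_χ^{V₂} X₂) Φ₂` for ALL `Φ₁, Φ₂` (★ `inlG_eq_blkD`, §3 at `Ψ_j := R⁻¹(Φ_j ⊠ Θ-witness)`, the two
  undoubling product formulas ★ `omegaD_inlG_piSBReindex_symm_tensorToSum`, the 4-fold shuffle ★ `sumTensor_idxSplitD_tensorToSum`, `⊠ T`-cancellation).

WHY THIS IS (O44) OF #44∕45R.  The doubled line-theta kernel of ★ D8 `K2Lit/DoubledLineThetaKernel` lives in the `L⁺`-rational Schrödinger model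
`𝒮(𝔸^{n″})` of `𝕎_𝔻 = Res((V ⊕ −V) ⊗ ⟨a′⟩) = 𝕎_V ⊕ 𝕎_{−V}` (★ `dD = (t₀ ‖ −t₀) ∘ finSumFinEquiv⁻¹`), so «undoubling on `ι(G × G)`» [HarrisKudlaSweet1996,
Lem. 1.1 p. 953] is §4 at `V₁ = ⟨t₀⟩`, `V₂ = ⟨−t₀⟩`, `W = ⟨a′⟩`, with NO character and no change of model; [HarrisKudlaSweet1996, (1.30)]'s `χ(det g₂)`
appears only afterwards, when slot 2 is moved from `χ_D = λ̃⁻¹` to `λ̃` (★ `chiSplittingLine_mul_ratioHecke`).  No definition, no instance, no named fact,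
no `sorry`; axioms ⊆ {propext, Classical.choice, Quot.sound}.

## References
* [Kudla1994] S. Kudla, *Splitting metaplectic covers of dual reductive pairs*, Israel J. Math. 87 (1994), §2, §3 Thm. 3.1.
* [Kudla1984] S. Kudla, *Seesaw dual reductive pairs*, Progr. Math. 46 (1984) 244–268, §1.
* [HarrisKudlaSweet1996] M. Harris, S. Kudla, W. J. Sweet, *Theta dichotomy for unitary groups*, J. AMS 9 (1996), §1 (1.8)–(1.15), Lem. 1.1 p. 953, (1.30).
* [GelbartRogawski1991] S. Gelbart, J. Rogawski, Invent. Math. 105 (1991), §3.1 Prop. 3.1.1 p. 455, Remark p. 457.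
* [MoeglinVignerasWaldspurger1987] C. Mœglin, M.-F. Vignéras, J.-L. Waldspurger, LNM 1291 (1987), Chap. 2 II.1 Rem. (6).

HONEST LABEL: HC_CM is proved only modulo the 7 printed citations (2 remaining named inputs: hLiu418 = stmt-HodgeConjecture-24832, h413 =
stmt-HodgeConjecture-24833) until rung 0 closes; this helper moves no counter.
-/

set_option autoImplicit false

set_option linter.dupNamespace false

noncomputable section

open scoped Classical
open scoped Matrix Kronecker
open NumberField IsDedekindDomain
open Literature.RepresentationTheory.HeisenbergGroup
open Literature.NumberTheory.Automorphic
open Literature.NumberTheory.Weil1964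
open Literature.RepresentationTheory.HarrisKudlaSweet1996
open Literature.NumberTheory.GaloisRepresentations

namespace Summit.HodgeConjecture.HodgeConjecture.Cruxes.HLiu418.K2LiuDoubledSeesawBothSlots

open Literature.NumberTheory.GelbartRogawski1991 Literature.NumberTheory.GelbartRogawski1991.UnitaryDualPair
open Literature.NumberTheory.GelbartRogawski1991.GRConstruction
open Literature.NumberTheory.Automorphic.Liu2021.Def411WeilCarriersDoubling

/-! ## §0 Abstract bookkeeping -/

/-- **The parabolic comparison on the SECOND factor, abstractly** (mirror of the private `seesaw_scalar_eq_one_of_parabolic` of ★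
`DoubledSeesawParabolic` §7.0).  Three spaces `PV, PA, PB` with a "tensor" `τ : PA → PB → PV` and evaluation functionals `ev` multiplicative on `τ`;
operators `RV, RA, RB` («`ω(r_Δ)`») compatible with `τ` up to `κ ≠ 0`, with one-sided inverses `RV', RA', RB'`; an operator `SV` («`ω(sD_V(1,q))`») acting
on `τ` as `c • τ (SA ·) (SB ·)` with `SA = id`; and the two PARABOLIC identities for `V` and `V₂` at test vectors with `ev tA = ev tB = 1`.  If
`m_V = m_B ≠ 0` then `c = 1`. [folklore] -/
private theorem seesaw_scalar_eq_one_of_parabolic_right {PV PA PB : Type*} [AddCommGroup PV] [Module ℂ PV] [AddCommGroup PA]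
    [Module ℂ PA] [AddCommGroup PB] [Module ℂ PB]
    (τ : PA → PB → PV) (evV : PV → ℂ) (evA : PA → ℂ) (evB : PB → ℂ)
    (hevs : ∀ (a : ℂ) (z : PV), evV (a • z) = a * evV z) (hev : ∀ x y, evV (τ x y) = evA x * evB y)
    (RV RV' SV : PV →ₗ[ℂ] PV) (RA RA' SA : PA →ₗ[ℂ] PA) (RB RB' SB : PB →ₗ[ℂ] PB)
    (hRV : ∀ z, RV' (RV z) = z) (hRA : ∀ x, RA (RA' x) = x) (hRB : ∀ y, RB (RB' y) = y) (hSA : ∀ x, SA x = x)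
    (κ c mB mV : ℂ) (hκ0 : κ ≠ 0) (hmB : mB ≠ 0) (hm : mV = mB)
    (hR : ∀ x y, RV (τ x y) = κ • τ (RA x) (RB y)) (hS : ∀ x y, SV (τ x y) = c • τ (SA x) (SB y))
    (tA : PA) (tB : PB) (htA : evA tA = 1) (htB : evB tB = 1)
    (hparV : evV (RV (SV (RV' (τ tA tB)))) = mV * evV (τ tA tB))
    (hparB : evB (RB (SB (RB' tB))) = mB * evB tB) :
    c = 1 := by
  -- `RV' (τ tA tB) = κ⁻¹ • τ (RA' tA) (RB' tB)`
  have h1 : RV (τ (RA' tA) (RB' tB)) = κ • τ tA tB := by rw [hR, hRA, hRB]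
  have h2 : RV' (τ tA tB) = κ⁻¹ • τ (RA' tA) (RB' tB) := by
    have h := congrArg RV' h1
    rw [hRV, map_smul] at h
    rw [h, smul_smul, inv_mul_cancel₀ hκ0, one_smul]
  -- push `SV`, then `RV`
  have h3 : RV (SV (RV' (τ tA tB))) = c • τ tA (RB (SB (RB' tB))) := by
    rw [h2, map_smul, hS, hSA, map_smul, map_smul, hR, hRA, smul_smul, smul_smul, mul_comm κ⁻¹ c, mul_assoc,
      inv_mul_cancel₀ hκ0, mul_one]
  rw [h3, hevs, hev, hparB, htA, htB, hev, htA, htB, hm] at hparV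
  simp only [mul_one, one_mul] at hparV
  -- `hparV : c * mB = mB`
  exact mul_right_cancel₀ hmB (hparV.trans (one_mul mB).symm)

/-- `ρ g⁻¹ (ρ g v) = v` for a representation. [folklore] -/
private theorem rep_inv_apply_apply {G V : Type*} [Group G] [AddCommMonoid V] [Module ℂ V] (ρ : Representation ℂ G V) (g : G) (v : V) :
    ρ g⁻¹ (ρ g v) = v := by
  rw [← Module.End.mul_apply, ← map_mul, inv_mul_cancel, map_one, Module.End.one_apply]

/-- `ρ g (ρ g⁻¹ v) = v` for a representation. [folklore] -/
private theorem rep_apply_inv_apply {G V : Type*} [Group G] [AddCommMonoid V] [Module ℂ V] (ρ : Representation ℂ G V) (g : G) (v : V) :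
    ρ g (ρ g⁻¹ v) = v := by
  rw [← Module.End.mul_apply, ← map_mul, mul_inv_cancel, map_one, Module.End.one_apply]

/-- **See-saw bookkeeping on the SECOND factor** (mirror of ★ `Weil1964.mpSeesawCharSum_inl_eq_one_of_rigid`): if the see-saw character of
`(S, s₁ ∘ pr₁, s₂ ∘ pr₂)` is `1` at every `(1, q)` with `q` in a set `Q₂` of «parabolic points» of `P₂`, the three homomorphisms are continuous, and `P₂` is
RIGID for `Q₂` (every continuous character of `P₂` trivial on `Q₂` is trivial), then the see-saw character is `1` on `{1} × P₂`. [cite: Kudla1984, §1]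
[cite: GelbartRogawski1991, §3.1 Remark p. 457] -/
theorem mpSeesawCharSum_inr_eq_one_of_rigid {F : Type} [Field F] [NumberField F] {κ κ₁ κ₂ : Type} [Fintype κ] [DecidableEq κ]
    [Fintype κ₁] [DecidableEq κ₁] [Fintype κ₂] [DecidableEq κ₂] (e : κ ≃ κ₁ ⊕ κ₂)
    {T : Matrix κ κ (AdeleRing (𝓞 F) F)} {T₁ : Matrix κ₁ κ₁ (AdeleRing (𝓞 F) F)} {T₂ : Matrix κ₂ κ₂ (AdeleRing (𝓞 F) F)}
    (hT : Matrix.reindex e e T = Matrix.fromBlocks T₁ 0 0 T₂)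
    {P₁ P₂ : Type*} [Group P₁] [Group P₂] [TopologicalSpace P₁] [TopologicalSpace P₂]
    (S : P₁ × P₂ →* adelicMpCont F κ T) (s₁ : P₁ →* adelicMpCont F κ₁ T₁) (s₂ : P₂ →* adelicMpCont F κ₂ T₂)
    (hS : ∀ p : P₁ × P₂,
      (UnitaryGroup.spReindex e T (adelicMpCont.proj F κ T (S p))).1 =
        (UnitaryGroup.spSum T₁ T₂ (adelicMpCont.proj F κ₁ T₁ ((s₁.comp (MonoidHom.fst P₁ P₂)) p),
          adelicMpCont.proj F κ₂ T₂ ((s₂.comp (MonoidHom.snd P₁ P₂)) p))).1)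
    (hT₁ : IsUnit T₁) (hT₂ : IsUnit T₂)
    (hc : Continuous S) (hc₁ : Continuous s₁) (hc₂ : Continuous s₂)
    (Q₂ : Set P₂)
    (hQ : ∀ q ∈ Q₂, mpSeesawCharSum e hT S (s₁.comp (MonoidHom.fst P₁ P₂)) (s₂.comp (MonoidHom.snd P₁ P₂))
      hS hT₁ hT₂ (1, q) = 1)
    (hrigid : ∀ η : P₂ →* ℂˣ, (Continuous fun p => ((η p : ℂˣ) : ℂ)) → (∀ q ∈ Q₂, η q = 1) → η = 1)
    (p₂ : P₂) :
    mpSeesawCharSum e hT S (s₁.comp (MonoidHom.fst P₁ P₂)) (s₂.comp (MonoidHom.snd P₁ P₂)) hS hT₁ hT₂ (1, p₂) = 1 := by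
  have hcont : Continuous fun p : P₁ × P₂ =>
      ((mpSeesawCharSum e hT S (s₁.comp (MonoidHom.fst P₁ P₂)) (s₂.comp (MonoidHom.snd P₁ P₂)) hS hT₁ hT₂ p : ℂˣ) : ℂ) :=
    continuous_mpSeesawCharSum e hT S _ _ hS hT₁ hT₂ hc (hc₁.comp continuous_fst) (hc₂.comp continuous_snd)
  -- (make the see-saw character an opaque local: keeps `isDefEq` off the `mpSeesawCharSum` telescope)
  generalize mpSeesawCharSum e hT S (s₁.comp (MonoidHom.fst P₁ P₂)) (s₂.comp (MonoidHom.snd P₁ P₂)) hS hT₁ hT₂ = c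
    at hQ hcont ⊢
  have hη : c.comp (MonoidHom.inr P₁ P₂) = 1 :=
    hrigid (c.comp (MonoidHom.inr P₁ P₂)) (hcont.comp (continuous_const.prodMk continuous_id)) (fun q hq => hQ q hq)
  have h := DFunLike.congr_fun hη p₂
  rwa [MonoidHom.comp_apply, MonoidHom.inr_apply, MonoidHom.one_apply] at h

section BothSlots

variable (L : Type) [Field L] [NumberField L] [IsCMField L]

variable {N₁ N₂ M n n₁ n₂ : ℕ} (eV : Fin (N₁ + N₂) × Fin M ≃ Fin n) (eA : Fin N₁ × Fin M ≃ Fin n₁)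
  (eB : Fin N₂ × Fin M ≃ Fin n₂)

variable (dA : Fin N₁ → L) (hdA : ∀ i, IsCMField.complexConj L (dA i) = dA i) (hdA0 : ∀ i, dA i ≠ 0)
  (dB : Fin N₂ → L) (hdB : ∀ i, IsCMField.complexConj L (dB i) = dB i) (hdB0 : ∀ i, dB i ≠ 0)
  (dV : Fin (N₁ + N₂) → L) (hdV : ∀ i, IsCMField.complexConj L (dV i) = dV i) (hdV0 : ∀ i, dV i ≠ 0)
  (hVA : ∀ i, dV (Fin.castAdd N₂ i) = dA i) (hVB : ∀ j, dV (Fin.natAdd N₁ j) = dB j)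
  (dW : Fin M → L) (hdW : ∀ i, IsCMField.complexConj L (dW i) = dW i) (hdW0 : ∀ i, dW i ≠ 0)

/-! ## §1 The prescribed scalar of `blkD (1, q)` -/

/-- **`blkD (1, q)` of a Siegel `q` with unit `det_Δ` carries the SAME prescribed scalar `χ(det_Δ) |det_Δ|^{1/2}` as `q`** (mirror of ★
`chiDet_mul_modDelta_blkD_inl`). [cite: Kudla1994, §2 (doubled space, Siegel parabolic), Thm. 3.1] [cite: HarrisKudlaSweet1996, §1 (1.14)–(1.15)] -/
theorem chiDet_mul_modDelta_blkD_inr (χ : HeckeCharacter L) {q : HA L eB dB hdB dW hdW}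
    (hq : IsUnit (detDelta L eB dB hdB dW hdW q)) :
    ((chiDet L eV dV hdV dW hdW χ (blkD L eV eA eB dA hdA dB hdB dV hdV hVA hVB dW hdW (1, q)) : ℂˣ) : ℂ) *
        (modDelta L eV dV hdV dW hdW (blkD L eV eA eB dA hdA dB hdB dV hdV hVA hVB dW hdW (1, q)) : ℂ) =
      ((chiDet L eB dB hdB dW hdW χ q : ℂˣ) : ℂ) * (modDelta L eB dB hdB dW hdW q : ℂ) := by
  have h1 : IsUnit (detDelta L eA dA hdA dW hdW (1 : HA L eA dA hdA dW hdW)) := by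
    rw [detDelta_one']; exact isUnit_one
  rw [chiDet_blkD L eV eA eB dA hdA dB hdB dV hdV hVA hVB dW hdW χ (h := (1, q)) h1 hq,
    modDelta_blkD L eV eA eB dA hdA dB hdB dV hdV hVA hVB dW hdW (h := (1, q)) h1 hq, chiDet_one', modDelta_one',
    one_mul, one_mul]

/-- `|det_Δ p|^{1/2} ≠ 0`. [folklore] -/
private theorem modDelta_ne_zero'' {N m : ℕ} (e : Fin N × Fin M ≃ Fin m) (d : Fin N → L) (hd : ∀ i, IsCMField.complexConj L (d i) = d i)
    (p : HA L e d hd dW hdW) : modDelta L e d hd dW hdW p ≠ 0 := by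
  unfold modDelta
  split_ifs with hu
  · rw [← coe_ideleNorm]
    exact Real.sqrt_ne_zero'.mpr (NNReal.coe_pos.mpr (pos_iff_ne_zero.mpr (ideleNorm_ne_zero _)))
  · exact one_ne_zero

/-! ## §2 The see-saw character is `1` on `1 × H(V₂)(𝔸)` -/

variable (χ : HeckeCharacter L)
  {sDV : HA L eV dV hdV dW hdW →* MpD L eV dV hdV dW hdW}
  {sDA : HA L eA dA hdA dW hdW →* MpD L eA dA hdA dW hdW}
  {sDB : HA L eB dB hdB dW hdW →* MpD L eB dB hdB dW hdW}

/-- **the parabolic comparison on the second factor**: for `q ∈ P_Δ(V₂)(𝔸)` with unit `det_Δ q`, the see-saw character of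
`(sD_V ∘ blkD, sD_{V₁}, sD_{V₂})` is `1` at `(1, q)`.  PROOF: V's parabolic clause at `p = blkD (1,q)` on `Ψ := testVec ⊠_σ testVec` and V₂'s at `testVec`,
read through `κ` (★ `exists_kappa`) and the defining identity of the character, give `c · χ(det_Δ q)|det_Δ q|^{1/2} = χ(det_Δ (blkD (1,q)))|det_Δ (blkD (1,q))|^{1/2}`,
and §1 says the two prescribed scalars agree. [cite: Kudla1994, §2 (doubled space, Siegel parabolic), Thm. 3.1] [cite: HarrisKudlaSweet1996, §1 (1.14)–(1.15)] -/
theorem seesawCharBlkD_eq_one_of_isSiegelDelta_inr (hDV : IsDoubledWeilRep L eV dV hdV hdV0 dW hdW hdW0 χ sDV)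
    (hDA : IsDoubledWeilRep L eA dA hdA hdA0 dW hdW hdW0 χ sDA) (hDB : IsDoubledWeilRep L eB dB hdB hdB0 dW hdW hdW0 χ sDB)
    {q : HA L eB dB hdB dW hdW} (hq : IsSiegelDelta L eB dB hdB dW hdW q) (hqu : IsUnit (detDelta L eB dB hdB dW hdW q)) :
    seesawCharBlkD L eV eA eB dA hdA hdA0 dB hdB hdB0 dV hdV hdV0 hVA hVB dW hdW hdW0 χ hDV hDA hDB (1, q) = 1 := by
  obtain ⟨κ, hκ0, hκ⟩ := exists_kappa L eV eA eB dA hdA hdA0 dB hdB hdB0 dV hdV hdV0 hVA hVB dW hdW hdW0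
  -- Siegel data of `blkD (1, q)`
  have h1u : IsUnit (detDelta L eA dA hdA dW hdW (1 : HA L eA dA hdA dW hdW)) := by
    rw [detDelta_one']; exact isUnit_one
  have hp : IsSiegelDelta L eV dV hdV dW hdW (blkD L eV eA eB dA hdA dB hdB dV hdV hVA hVB dW hdW (1, q)) :=
    isSiegelDelta_blkD L eV eA eB dA hdA dB hdB dV hdV hVA hVB dW hdW (isSiegelDelta_one' L eA dA hdA dW hdW) hq
  have hpu : IsUnit (detDelta L eV dV hdV dW hdW (blkD L eV eA eB dA hdA dB hdB dV hdV hVA hVB dW hdW (1, q))) :=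
    isUnit_detDelta_blkD L eV eA eB dA hdA dB hdB dV hdV hVA hVB dW hdW (h := (1, q)) h1u hqu
  -- the two parabolic clauses, `ω` of a triple product unfolded
  have hparV := hDV.parabolic _ hp hpu (sumTensor (Fp L) (idxSplitD eV eA eB) (testVec L) (testVec L))
  have hparB := hDB.parabolic q hq hqu (testVec L)
  rw [opD_mul, opD_mul] at hparV hparB
  -- the two prescribed scalars agree
  have hm := chiDet_mul_modDelta_blkD_inr L eV eA eB dA hdA dB hdB dV hdV hVA hVB dW hdW χ (q := q) hqu
  have hmB : ((chiDet L eB dB hdB dW hdW χ q : ℂˣ) : ℂ) * (modDelta L eB dB hdB dW hdW q : ℂ) ≠ 0 :=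
    mul_ne_zero (Units.ne_zero _) (Complex.ofReal_ne_zero.2 (modDelta_ne_zero'' L dW hdW eB dB hdB q))
  -- assemble by the abstract lemma
  refine Units.val_eq_one.mp ?_
  exact seesaw_scalar_eq_one_of_parabolic_right
    (sumTensor (Fp L) (idxSplitD eV eA eB))
    (fun Φ => ((Φ : piSchwartzBruhat (Fp L) (Fin (n + n))) : (Fin (n + n) → (AdeleRing (𝓞 (Fp L)) (Fp L))) → ℂ) 0)
    (fun Φ => ((Φ : piSchwartzBruhat (Fp L) (Fin (n₁ + n₁))) : (Fin (n₁ + n₁) → (AdeleRing (𝓞 (Fp L)) (Fp L))) → ℂ) 0)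
    (fun Φ => ((Φ : piSchwartzBruhat (Fp L) (Fin (n₂ + n₂))) : (Fin (n₂ + n₂) → (AdeleRing (𝓞 (Fp L)) (Fp L))) → ℂ) 0)
    (fun a z => rfl) (fun x y => by rw [coe_sumTensor_apply]; rfl)
    (adelicMpCont.omega (Fp L) (Fin (n + n)) (gramDA L eV dV hdV dW hdW) (rDelta L eV dV hdV hdV0 dW hdW hdW0))
    (adelicMpCont.omega (Fp L) (Fin (n + n)) (gramDA L eV dV hdV dW hdW) (rDelta L eV dV hdV hdV0 dW hdW hdW0)⁻¹)
    (adelicMpCont.omega (Fp L) (Fin (n + n)) (gramDA L eV dV hdV dW hdW)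
      (sDV (blkD L eV eA eB dA hdA dB hdB dV hdV hVA hVB dW hdW (1, q))))
    (adelicMpCont.omega (Fp L) (Fin (n₁ + n₁)) (gramDA L eA dA hdA dW hdW) (rDelta L eA dA hdA hdA0 dW hdW hdW0))
    (adelicMpCont.omega (Fp L) (Fin (n₁ + n₁)) (gramDA L eA dA hdA dW hdW) (rDelta L eA dA hdA hdA0 dW hdW hdW0)⁻¹)
    (adelicMpCont.omega (Fp L) (Fin (n₁ + n₁)) (gramDA L eA dA hdA dW hdW) (sDA 1))
    (adelicMpCont.omega (Fp L) (Fin (n₂ + n₂)) (gramDA L eB dB hdB dW hdW) (rDelta L eB dB hdB hdB0 dW hdW hdW0))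
    (adelicMpCont.omega (Fp L) (Fin (n₂ + n₂)) (gramDA L eB dB hdB dW hdW) (rDelta L eB dB hdB hdB0 dW hdW hdW0)⁻¹)
    (adelicMpCont.omega (Fp L) (Fin (n₂ + n₂)) (gramDA L eB dB hdB dW hdW) (sDB q))
    (fun z => rep_inv_apply_apply _ _ z) (fun x => rep_apply_inv_apply _ _ x) (fun y => rep_apply_inv_apply _ _ y)
    (fun x => by simp only [map_one, Module.End.one_apply])
    κ _ _ _ hκ0 hmB hm hκ
    (fun x y => seesawCharBlkD_spec L eV eA eB dA hdA hdA0 dB hdB hdB0 dV hdV hdV0 hVA hVB dW hdW hdW0 χ hDV hDA hDB (1, q) x y)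
    (testVec L) (testVec L) (testVec_zero L) (testVec_zero L) hparV hparB

/-- **The see-saw character is `1` on `1 × H(V₂)(𝔸)`** (mirror of ★ `seesawCharBlkD_inl_eq_one`): by §2 at the Siegel points and RIGIDITY
(★ `IsDoubledWeilRep.monoidHom_eq_one_of_forall_isSiegelDelta`): `H(V₂)(𝔸)` has no continuous character trivial on `P_Δ(V₂)(𝔸)` that twists `sD_{V₂}`.
[cite: Kudla1994, §3 Thm. 3.1] [cite: Kudla1984, §1] [cite: GelbartRogawski1991, §3.1 Prop. 3.1.1 p. 455, Remark p. 457] -/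
theorem seesawCharBlkD_inr_eq_one (hχu : χ.IsUnitary) (hχs : IsSplittingChar L 1 χ)
    (hDV : IsDoubledWeilRep L eV dV hdV hdV0 dW hdW hdW0 χ sDV)
    (hDA : IsDoubledWeilRep L eA dA hdA hdA0 dW hdW hdW0 χ sDA) (hDB : IsDoubledWeilRep L eB dB hdB hdB0 dW hdW hdW0 χ sDB)
    (h₂ : HA L eB dB hdB dW hdW) :
    seesawCharBlkD L eV eA eB dA hdA hdA0 dB hdB hdB0 dV hdV hdV0 hVA hVB dW hdW hdW0 χ hDV hDA hDB (1, h₂) = 1 := by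
  unfold seesawCharBlkD
  exact mpSeesawCharSum_inr_eq_one_of_rigid (idxSplitD eV eA eB)
    (reindex_idxSplitD_gramDA L eV eA eB dA hdA dB hdB dV hdV hVA hVB dW hdW)
    (sDV.comp (blkD L eV eA eB dA hdA dB hdB dV hdV hVA hVB dW hdW)) sDA sDB
    (spReindex_proj_comp_blkD L eV eA eB dA hdA hdA0 dB hdB hdB0 dV hdV hdV0 hVA hVB dW hdW hdW0 χ hDV hDA hDB)
    (isUnit_gramDA' L dW hdW hdW0 eA dA hdA hdA0) (isUnit_gramDA' L dW hdW hdW0 eB dB hdB hdB0)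
    (hDV.continuous.comp (continuous_blkD L eV eA eB dA hdA dB hdB dV hdV hVA hVB dW hdW)) hDA.continuous hDB.continuous
    {q | IsSiegelDelta L eB dB hdB dW hdW q ∧ IsUnit (detDelta L eB dB hdB dW hdW q)}
    (fun q hq => seesawCharBlkD_eq_one_of_isSiegelDelta_inr L eV eA eB dA hdA hdA0 dB hdB hdB0 dV hdV hdV0 hVA hVB dW hdW hdW0 χ
      hDV hDA hDB hq.1 hq.2)
    (fun η hηc hη => IsDoubledWeilRep.monoidHom_eq_one_of_forall_isSiegelDelta L eB dB hdB hdB0 dW hdW hdW0 χ hχu hχs hDB η hηc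
      fun p hp hu => hη p ⟨hp, hu⟩)
    h₂

/-! ## §3 The see-saw character is trivial: the doubled Weil representation of `V₁ ⊕ V₂` restricts to the outer tensor product -/

/-- **THE SEE-SAW CHARACTER OF THE DOUBLED TRIPLE IS TRIVIAL**: `seesawCharBlkD (h₁, h₂) = 1` for all `h₁, h₂` — `(h₁, h₂) = (h₁, 1)·(1, h₂)`, ★
`seesawCharBlkD_inl_eq_one` and §2. [cite: Kudla1994, §2, §3 Thm. 3.1] [cite: HarrisKudlaSweet1996, §1 (1.8)–(1.9)] [cite: Kudla1984, §1] -/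
theorem seesawCharBlkD_eq_one (hχu : χ.IsUnitary) (hχs : IsSplittingChar L 1 χ)
    (hDV : IsDoubledWeilRep L eV dV hdV hdV0 dW hdW hdW0 χ sDV)
    (hDA : IsDoubledWeilRep L eA dA hdA hdA0 dW hdW hdW0 χ sDA) (hDB : IsDoubledWeilRep L eB dB hdB hdB0 dW hdW hdW0 χ sDB)
    (h : HA L eA dA hdA dW hdW × HA L eB dB hdB dW hdW) :
    seesawCharBlkD L eV eA eB dA hdA hdA0 dB hdB hdB0 dV hdV hdV0 hVA hVB dW hdW hdW0 χ hDV hDA hDB h = 1 := by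
  have hsplit : h = (h.1, 1) * (1, h.2) := (Prod.fst_mul_snd h).symm
  rw [hsplit, map_mul, seesawCharBlkD_inl_eq_one L eV eA eB dA hdA hdA0 dB hdB hdB0 dV hdV hdV0 hVA hVB dW hdW hdW0 χ hχu hχs hDV hDA hDB h.1,
    seesawCharBlkD_inr_eq_one L eV eA eB dA hdA hdA0 dB hdB hdB0 dV hdV hdV0 hVA hVB dW hdW hdW0 χ hχu hχs hDV hDA hDB h.2, one_mul]

/-- **THE DOUBLED SEE-SAW IDENTITY ON PURE `σ`-TENSORS, BOTH SLOTS**: for the `χ`-normalised doubled Weil representations `sD_V, sD_{V₁}, sD_{V₂}` of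
`V = V₁ ⊕ V₂` (same partner `W`), `ω(sD_V (blkD (h₁, h₂))) (Φ₁ ⊠_σ Φ₂) = ω(sD_{V₁} h₁) Φ₁ ⊠_σ ω(sD_{V₂} h₂) Φ₂` — on `H(V₁)(𝔸) × H(V₂)(𝔸)` the doubled Weil
representation of `V₁ ⊕ V₂` is the outer tensor product of those of `V₁` and `V₂` («`ω_ψ ∘ j ≃ ω_{ψ,1} ⊠ ω_{ψ,2}`» with the `χ`-splittings).
[cite: Kudla1994, §2, §3 Thm. 3.1] [cite: HarrisKudlaSweet1996, §1 (1.8)–(1.9)] [cite: MoeglinVignerasWaldspurger1987, Chap. 2 II.1 Rem. (6)] -/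
theorem omega_blkD_sumTensor (hχu : χ.IsUnitary) (hχs : IsSplittingChar L 1 χ)
    (hDV : IsDoubledWeilRep L eV dV hdV hdV0 dW hdW hdW0 χ sDV)
    (hDA : IsDoubledWeilRep L eA dA hdA hdA0 dW hdW hdW0 χ sDA) (hDB : IsDoubledWeilRep L eB dB hdB hdB0 dW hdW hdW0 χ sDB)
    (h : HA L eA dA hdA dW hdW × HA L eB dB hdB dW hdW)
    (Φ₁ : piSchwartzBruhat (Fp L) (Fin (n₁ + n₁))) (Φ₂ : piSchwartzBruhat (Fp L) (Fin (n₂ + n₂))) :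
    adelicMpCont.omega (Fp L) (Fin (n + n)) (gramDA L eV dV hdV dW hdW)
        (sDV (blkD L eV eA eB dA hdA dB hdB dV hdV hVA hVB dW hdW h)) (sumTensor (Fp L) (idxSplitD eV eA eB) Φ₁ Φ₂) =
      sumTensor (Fp L) (idxSplitD eV eA eB)
        (adelicMpCont.omega (Fp L) (Fin (n₁ + n₁)) (gramDA L eA dA hdA dW hdW) (sDA h.1) Φ₁)
        (adelicMpCont.omega (Fp L) (Fin (n₂ + n₂)) (gramDA L eB dB hdB dW hdW) (sDB h.2) Φ₂) := by
  have hs := seesawCharBlkD_spec L eV eA eB dA hdA hdA0 dB hdB hdB0 dV hdV hdV0 hVA hVB dW hdW hdW0 χ hDV hDA hDB h Φ₁ Φ₂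
  have hc : (seesawCharBlkD L eV eA eB dA hdA hdA0 dB hdB hdB0 dV hdV hdV0 hVA hVB dW hdW hdW0 χ hDV hDA hDB h : ℂ) = 1 := by
    rw [seesawCharBlkD_eq_one L eV eA eB dA hdA hdA0 dB hdB hdB0 dV hdV hdV0 hVA hVB dW hdW hdW0 χ hχu hχs hDV hDA hDB h, Units.val_one]
  exact hs.trans ((congrArg (· • _) hc).trans (one_smul ℂ _))

/-! ## §4 Undoubling: the both-slot identity for the `χ`-attached splittings -/

include dA hdA hdA0 dB hdB hdB0 hVA hVB in
/-- **UNDOUBLED, BOTH SLOTS.**  For `X ∈ G₁(V)(𝔸) = U(diag dV ⊗ diag dW)(𝔸)` and `X_j ∈ G₁(V_j)(𝔸)` with `reindex e_Σ e_Σ X = diag(X₁, X₂)` (`X` = "`X₁` on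
`V₁ ⊗ W`, `X₂` on `V₂ ⊗ W`"), the `χ`-attached compatible splittings satisfy `ω(s_χ^V X) (Φ₁ ⊠_ι Φ₂) = ω(s_χ^{V₁} X₁) Φ₁ ⊠_ι ω(s_χ^{V₂} X₂) Φ₂` for ALL
`Φ₁, Φ₂` — §3 at `Ψ_j := R⁻¹(Φ_j ⊠ Θ-witness)`, undoubled by the two product formulas and `⊠ T`-cancellation (the slot-1 case `X₂ = 1` is ★
`omega_chiSplitting_sumTensor_idxSplit`).  This is the undoubling «`ω_{V₁⊕V₂,χ}|_{U(V₁) × U(V₂)} = ω_{V₁,χ} ⊠ ω_{V₂,χ}`» on pure tensors, with NO character.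
[cite: HarrisKudlaSweet1996, §1 Lem. 1.1 p. 953, (1.8)–(1.9)] [cite: Kudla1994, §2, §3 Thm. 3.1] [cite: Kudla1984, §1] -/
theorem omega_chiSplitting_sumTensor_idxSplit₂ (hχu : χ.IsUnitary) (hχs : IsSplittingChar L 1 χ)
    (X : ↥(UnitaryGroup.adelicPair (Fp L) L (IsCMField.complexConj L) (N₁ + N₂) M (Matrix.diagonal dV) (Matrix.diagonal dW)))
    (X₁ : ↥(UnitaryGroup.adelicPair (Fp L) L (IsCMField.complexConj L) N₁ M (Matrix.diagonal dA) (Matrix.diagonal dW)))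
    (X₂ : ↥(UnitaryGroup.adelicPair (Fp L) L (IsCMField.complexConj L) N₂ M (Matrix.diagonal dB) (Matrix.diagonal dW)))
    (hX : Matrix.reindex
        ((finSumFinEquiv.prodCongr (Equiv.refl (Fin M))).symm.trans (Equiv.sumProdDistrib (Fin N₁) (Fin N₂) (Fin M)))
        ((finSumFinEquiv.prodCongr (Equiv.refl (Fin M))).symm.trans (Equiv.sumProdDistrib (Fin N₁) (Fin N₂) (Fin M)))
        ((X : GL (Fin (N₁ + N₂) × Fin M) (AdeleRing (𝓞 L) L)) : Matrix (Fin (N₁ + N₂) × Fin M) (Fin (N₁ + N₂) × Fin M) (AdeleRing (𝓞 L) L)) =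
      Matrix.fromBlocks ((X₁ : GL (Fin N₁ × Fin M) (AdeleRing (𝓞 L) L)) : Matrix (Fin N₁ × Fin M) (Fin N₁ × Fin M) (AdeleRing (𝓞 L) L)) 0 0
        ((X₂ : GL (Fin N₂ × Fin M) (AdeleRing (𝓞 L) L)) : Matrix (Fin N₂ × Fin M) (Fin N₂ × Fin M) (AdeleRing (𝓞 L) L))) 
    (Φ₁ : piSchwartzBruhat (Fp L) (Fin n₁)) (Φ₂ : piSchwartzBruhat (Fp L) (Fin n₂)) :
    adelicMpCont.omega (Fp L) (Fin n) (gramA L eV dV hdV dW hdW)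
        (chiSplitting L eV dV hdV hdV0 dW hdW hdW0 χ hχu hχs X) (sumTensor (Fp L) (idxSplit eV eA eB) Φ₁ Φ₂) =
      sumTensor (Fp L) (idxSplit eV eA eB)
        (adelicMpCont.omega (Fp L) (Fin n₁) (gramA L eA dA hdA dW hdW)
          (chiSplitting L eA dA hdA hdA0 dW hdW hdW0 χ hχu hχs X₁) Φ₁)
        (adelicMpCont.omega (Fp L) (Fin n₂) (gramA L eB dB hdB dW hdW)
          (chiSplitting L eB dB hdB hdB0 dW hdW hdW0 χ hχu hχs X₂) Φ₂) := by
  have hDV := isDoubledWeilRep_doubledWeilRep L eV dV hdV hdV0 dW hdW hdW0 χ hχu hχs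
  have hDA := isDoubledWeilRep_doubledWeilRep L eA dA hdA hdA0 dW hdW hdW0 χ hχu hχs
  have hDB := isDoubledWeilRep_doubledWeilRep L eB dB hdB hdB0 dW hdW hdW0 χ hχu hχs
  -- (K) `ι_V X = blkD (ι_{V₁} X₁, ι_{V₂} X₂)`
  have hK := inlG_eq_blkD L eV eA eB dA hdA dB hdB dV hdV hVA hVB dW hdW X X₁ X₂ hX
  -- the test functions
  have hT0 := sumTensor_testVec_ne_zero L eV eA eB (n₁ := n₁) (n₂ := n₂)
  -- §3 at `Ψ_j := R⁻¹(Φ_j ⊠ witness)`, `h := (ι_{V₁} X₁, ι_{V₂} X₂)`, moved to `ι_V X` along `hK`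
  have hD := omega_blkD_sumTensor L eV eA eB dA hdA hdA0 dB hdB hdB0 dV hdV hdV0 hVA hVB dW hdW hdW0 χ hχu hχs hDV hDA hDB
    (inlG L eA dA hdA dW hdW X₁, inlG L eB dB hdB dW hdW X₂)
    ((piSBReindex (Fp L) (finSumFinEquiv (m := n₁) (n := n₁)).symm).symm
      (tensorToSum (Fp L) (Fin n₁) (Fin n₁) Φ₁ (testVec L (n := n₁))))
    ((piSBReindex (Fp L) (finSumFinEquiv (m := n₂) (n := n₂)).symm).symm
      (tensorToSum (Fp L) (Fin n₂) (Fin n₂) Φ₂ (testVec L (n := n₂))))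
  have hKD := (congrArg (fun h => adelicMpCont.omega (Fp L) (Fin (n + n)) (gramDA L eV dV hdV dW hdW)
      (doubledWeilRep L eV dV hdV hdV0 dW hdW hdW0 χ hχu hχs h)
      (sumTensor (Fp L) (idxSplitD eV eA eB)
        ((piSBReindex (Fp L) (finSumFinEquiv (m := n₁) (n := n₁)).symm).symm
          (tensorToSum (Fp L) (Fin n₁) (Fin n₁) Φ₁ (testVec L (n := n₁))))
        ((piSBReindex (Fp L) (finSumFinEquiv (m := n₂) (n := n₂)).symm).symm
          (tensorToSum (Fp L) (Fin n₂) (Fin n₂) Φ₂ (testVec L (n := n₂)))))) hK).trans hD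
  -- the two undoubling product formulas
  have hUA := omegaD_inlG_piSBReindex_symm_tensorToSum L dW hdW hdW0 eA dA hdA hdA0 hDA.proj_eq X₁ Φ₁ (testVec L (n := n₁))
  have hUB := omegaD_inlG_piSBReindex_symm_tensorToSum L dW hdW hdW0 eB dB hdB hdB0 hDB.proj_eq X₂ Φ₂ (testVec L (n := n₂))
  have hUV := omegaD_inlG_piSBReindex_symm_tensorToSum L dW hdW hdW0 eV dV hdV hdV0 hDV.proj_eq X
    (sumTensor (Fp L) (idxSplit eV eA eB) Φ₁ Φ₂) (sumTensor (Fp L) (idxSplit eV eA eB) (testVec L (n := n₁)) (testVec L (n := n₂)))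
  -- LHS: the shuffle, then the product formula of `V`
  have hL := (congrArg (adelicMpCont.omega (Fp L) (Fin (n + n)) (gramDA L eV dV hdV dW hdW)
      (doubledWeilRep L eV dV hdV hdV0 dW hdW hdW0 χ hχu hχs (inlG L eV dV hdV dW hdW X)))
      (sumTensor_idxSplitD_tensorToSum (Fp L) eV eA eB Φ₁ (testVec L (n := n₁)) Φ₂ (testVec L (n := n₂)))).trans hUV
  -- RHS: the product formulas of `V₁` and `V₂`, then the shuffle
  have hR := (congrArg₂ (sumTensor (Fp L) (idxSplitD eV eA eB)) hUA hUB).trans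
    (sumTensor_idxSplitD_tensorToSum (Fp L) eV eA eB _ (testVec L (n := n₁)) _ (testVec L (n := n₂)))
  -- compare and cancel
  have h := (hL.symm.trans hKD).trans hR
  exact tensorToSum_left_cancel hT0 ((piSBReindex (Fp L) (finSumFinEquiv (m := n) (n := n)).symm).symm.injective h)

end BothSlots

end Summit.HodgeConjecture.HodgeConjecture.Cruxes.HLiu418.K2LiuDoubledSeesawBothSlots

end
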